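import Summits.CriticalPhenomena.PercolationContinuityZ3.Theses.PercNearOneGluing
import Literature.Probability.Percolation.PercolationEvents
import HarnessLib.Audit
import Literature.Probability.LatticeModels.ProdBernoulliIndependence

/-! TTRL-lite variant V2403 of stmt-CriticalPhenomena-4574

(`stub_shorteningStep` of line `kn_shortening_induction`, move `small_case`: `A.card = 1`).
With a single relay `A = {a₀}` the union `⋃ a ∈ A, {v ↔ a}` is `{v ↔ a₀}`, and the shortening
step is exactly Harris' inequality for the glued product measure `prodBernoulli (w[s(v,x) ↦ 1])`
applied to the increasing events `{v ↔ a₀}`, `{a₀ ↔ b}`, followed by transitivity of open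
connection `{v ↔ a₀} ∩ {a₀ ↔ b} ⊆ {v ↔ b}`.  The minimiser and induction hypotheses are not used.
No new definitions, no named facts. -/

namespace Summit.CriticalPhenomena.PercolationContinuityZ3.Theorems

open MeasureTheory Set Literature.Probability.LatticeModels Literature.Probability.Percolation
open scoped Classical BigOperators

/-- TTRL-lite variant V2403 of `stub_shorteningStep` (stmt-CriticalPhenomena-4574, Kozma–Nitzan
Conjecture 6 with induction hypothesis), single-relay case `A.card = 1`: then `A = {a₀}` and
`μ(v ↔ a₀) · μ(a₀ ↔ b) ≤ μ(v ↔ a₀, a₀ ↔ b) ≤ μ(v ↔ b)` for `μ = prodBernoulli (w[s(v,x) ↦ 1])`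
by Harris' inequality (`prodBernoulli_harris`) and transitivity of `↔`. -/
theorem stub_shorteningStep_var2403 : ∀ (n : ℕ) (w : Sym2 (Fin n) → unitInterval) (A : Finset (Fin n)) (b v x a₀ : Fin n), A.card = 1 → v ∉ A → v ≠ x → w s(v, x) = 0 → a₀ ∈ A → (∀ a ∈ A, (prodBernoulli w).real (openConn a₀ b) ≤ (prodBernoulli w).real (openConn a b)) → (∀ w' : Sym2 (Fin n) → unitInterval, (∀ e, w e = 0 → w' e = 0) → ∀ (A' : Finset (Fin n)) (o' b' : Fin n) (t : ℝ), (∀ a ∈ A', t ≤ (prodBernoulli w').real (openConn a b')) → (prodBernoulli w').real (⋃ a ∈ A', openConn o' a) * t ≤ (prodBernoulli w').real (openConn o' b')) → (prodBernoulli (Function.update w s(v, x) 1)).real (⋃ a ∈ A, openConn v a) * (prodBernoulli (Function.update w s(v, x) 1)).real (openConn a₀ b) ≤ (prodBernoulli (Function.update w s(v, x) 1)).real (openConn v b) := by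
  intro n w A b v x a₀ hA _hvA _hvx _hw0 ha₀ _hmin _hIH
  -- a single relay: `A = {a₀}`
  have hAeq : A = {a₀} := by
    obtain ⟨a, ha⟩ := Finset.card_eq_one.1 hA
    rw [ha] at ha₀ ⊢
    rw [Finset.mem_singleton.1 ha₀]
  subst hAeq
  -- so the union of the events `{v ↔ a}`, `a ∈ A`, is `{v ↔ a₀}`
  have hU : (⋃ a ∈ ({a₀} : Finset (Fin n)), openConn v a : Set (BondConfig (Fin n))) =
      openConn v a₀ := by
    ext ω
    simp only [Finset.mem_singleton, mem_iUnion, exists_prop, exists_eq_left]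
  rw [hU]
  -- Harris' inequality for the two increasing events `{v ↔ a₀}`, `{a₀ ↔ b}`
  have hH : (prodBernoulli (Function.update w s(v, x) 1)).real (openConn v a₀) *
      (prodBernoulli (Function.update w s(v, x) 1)).real (openConn a₀ b) ≤
      (prodBernoulli (Function.update w s(v, x) 1)).real
        ((openConn v a₀ : Set (BondConfig (Fin n))) ∩ openConn a₀ b) :=
    prodBernoulli_harris _ (isUpperSet_openConn v a₀) (isUpperSet_openConn a₀ b)
      (Set.toFinite _).measurableSet (Set.toFinite _).measurableSet
  -- transitivity of open connection
  have hsub : ((openConn v a₀ : Set (BondConfig (Fin n))) ∩ openConn a₀ b) ⊆ openConn v b :=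
    fun ω hω => SimpleGraph.Reachable.trans hω.1 hω.2
  exact hH.trans (measureReal_mono hsub)

end Summit.CriticalPhenomena.PercolationContinuityZ3.Theorems
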